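import Summits.Ventures.PercRepro.S1SeparatorDisjointSum
import Summits.Ventures.PercRepro.S1DisjointSumCircuitLarge
import Summits.Ventures.PercRepro.S1DisjointSumTriangleNineFour
import Summits.Ventures.PercRepro.S1DisjointSumCircuitSevenFour
import Summits.Ventures.PercRepro.S1DisjointSumCircuitEightFour

/-!
# PercRepro — THE CIRCUIT-SUMMAND CONSUMERS FOR A MATROID WITH A CIRCUIT SEPARATOR (p2, gen 28; SUBCLAIM-S1
§6.10 (xvii)(g)–(h))

The consumers of `S1DisjointSumCircuit*` are stated for a literal `M.disjointSum N h`; through the bridge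
`eq_disjointSum_restrict_of_separator` they apply to any finite matroid `M` that HAS a circuit `C` which is a
separator (`ρ(E ∖ C) + ρ(C) = ρ(E)`): `M = (M ↾ (E ∖ C)) ⊕ (M ↾ C)`, the second part is a circuit of `|C|`
elements and the first has rank `ρ(E) − |C| + 1`. Hence, in the `RLS` form of the tree:
* `(9, 4)`: `ThmN.RLS M 9 4` when `|C| ≥ 4` and `M` is coloop-free; and when `|C| = 3` and `|E| = 14` (the
  `(9, 5)` cores) — every `(9, 5)` core with a circuit separator of any size;
* `(8, 4)`: `ThmN.RLS M 8 4` for every circuit separator of `≥ 3` elements of a coloop-free `M`;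
* `(7, 4)`: `ThmN.RLS M 7 4` for every circuit separator of `≥ 3` elements, no further hypothesis.
The non-circuit splits of the `(9, 5)` cell are in `S1SplitSeparatorConsumers`. Nothing else is claimed about any
cell.

* `circuit_separator_setup`, `circuit_separator_ranks`, `restrict_compl_coloops_eq_empty_of_circuit_separator` —
  the common unpacking (coloop-freeness passes to the other part);
* **`rls_nine_four_of_circuit_separator`**, **`rls_nine_four_of_triangle_separator_of_ncard`**,
  `rls_nine_four_of_triangle_separator_of_rls` (conditional on the other part's `(7, 4)`),
  **`rls_eight_four_of_circuit_separator`**, **`rls_seven_four_of_circuit_separator`**;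
* `rls_nine_four_of_two_circuit_separators` — a triangle separator and a second circuit separator of `≥ 3`
  elements (the `H ⊕ T ⊕ T` witnesses of the row-9 caps).
Axioms: standard.
-/

open scoped Matroid

namespace PercRepro

namespace S1

open Set

variable {α : Type}

/-- **The common unpacking of a circuit separator**: `M = (M ↾ (E ∖ C)) ⊕ (M ↾ C)`, `M ↾ C` is a circuit of
`|C|` elements on its ground set, and the ranks of the two restrictions are `ρ(E ∖ C)` and `|C| − 1`. -/
theorem circuit_separator_setup (M : Matroid α) [M.Finite] {C : Set α} (hC : M.IsCircuit C)
    (hsep : M.eRk (M.E \ C) + M.eRk C = M.eRank) :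
    (M = (M ↾ (M.E \ C)).disjointSum (M ↾ C)
        (by simp only [Matroid.restrict_ground_eq]; exact disjoint_sdiff_left)) ∧
      (M ↾ C).IsCircuit (M ↾ C).E ∧ (M ↾ C).eRank + 1 = ((M ↾ C).E.ncard : ℕ∞) ∧
      (M ↾ (M.E \ C)).eRank = M.eRk (M.E \ C) := by
  have hCE : C ⊆ M.E := hC.subset_ground
  have hA : M.E \ C ⊆ M.E := sdiff_subset
  have hsep' : M.eRk (M.E \ C) + M.eRk (M.E \ (M.E \ C)) = M.eRank := by
    rw [sdiff_sdiff_cancel_left hCE]; exact hsep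
  refine ⟨?_, ?_, ?_, rfl⟩
  · have h := eq_disjointSum_restrict_of_separator M hA hsep'
    convert h using 4
    exact (sdiff_sdiff_cancel_left hCE).symm
  · rw [Matroid.restrict_ground_eq, Matroid.restrict_isCircuit_iff hCE]
    exact ⟨hC, subset_rfl⟩
  · rw [Matroid.restrict_ground_eq, Matroid.eRank_restrict, hC.eRk_add_one_eq,
      (M.ground_finite.subset hCE).cast_ncard_eq]

/-- The ranks of the two parts of a circuit separator, as naturals: with `|C| = s + 1`, `ρ(C) = s`,
`ρ(E ∖ C) = r` and `r + s = ρ(E)`. -/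
theorem circuit_separator_ranks (M : Matroid α) [M.Finite] {C : Set α} (hC : M.IsCircuit C)
    (hsep : M.eRk (M.E \ C) + M.eRk C = M.eRank) {p s : ℕ} (hM : M.eRank = (p : ℕ∞))
    (hCs : C.ncard = s + 1) :
    ∃ r : ℕ, (M ↾ (M.E \ C)).eRank = (r : ℕ∞) ∧ r + s = p := by
  haveI hCfin : (M ↾ C).Finite := Matroid.restrict_finite (M.ground_finite.subset hC.subset_ground)
  obtain ⟨-, hcirc, -, hrkA⟩ := circuit_separator_setup M hC hsep
  have hCs' : (M ↾ C).E.ncard = s + 1 := by rw [Matroid.restrict_ground_eq]; exact hCs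
  have hCrk : M.eRk C = (s : ℕ∞) := by
    rw [← Matroid.eRank_restrict]; exact eRank_eq_of_isCircuit_ground hcirc hCs'
  have hrA_ne : M.eRk (M.E \ C) ≠ ⊤ :=
    ((M.eRk_le_encard _).trans_lt (M.ground_finite.subset sdiff_subset).encard_lt_top).ne
  obtain ⟨r, hr⟩ := ENat.ne_top_iff_exists.mp hrA_ne
  refine ⟨r, by rw [hrkA, ← hr], ?_⟩
  have h := hsep
  rw [← hr, hCrk, hM] at h
  exact_mod_cast h

/-- The coloop-freeness of the other part of a circuit separator, from that of `M`. -/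
theorem restrict_compl_coloops_eq_empty_of_circuit_separator (M : Matroid α) [M.Finite] {C : Set α}
    (hC : M.IsCircuit C) (hsep : M.eRk (M.E \ C) + M.eRk C = M.eRank) (hcol : M.coloops = ∅) :
    (M ↾ (M.E \ C)).coloops = ∅ := by
  have hsep' : M.eRk (M.E \ C) + M.eRk (M.E \ (M.E \ C)) = M.eRank := by
    rw [sdiff_sdiff_cancel_left hC.subset_ground]; exact hsep
  exact restrict_coloops_eq_empty_of_separator M sdiff_subset hsep' hcol

/-- **`(9, 4)` for a coloop-free matroid with a circuit separator of `≥ 4` elements.** -/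
theorem rls_nine_four_of_circuit_separator (M : Matroid α) [M.Finite] {C : Set α} (hC : M.IsCircuit C)
    (hsep : M.eRk (M.E \ C) + M.eRk C = M.eRank) (hC4 : 4 ≤ C.ncard) (hM : M.eRank = ((9 : ℕ) : ℕ∞))
    (hcolM : M.coloops = ∅) : ThmN.RLS M 9 4 := by
  have hcol := restrict_compl_coloops_eq_empty_of_circuit_separator M hC hsep hcolM
  obtain ⟨heq, hcirc, -, -⟩ := circuit_separator_setup M hC hsep
  haveI hAfin : (M ↾ (M.E \ C)).Finite := Matroid.restrict_finite (M.ground_finite.subset sdiff_subset)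
  haveI hCfin : (M ↾ C).Finite := Matroid.restrict_finite (M.ground_finite.subset hC.subset_ground)
  have hCs : C.ncard = (C.ncard - 1) + 1 := by omega
  obtain ⟨r, hr, hrs⟩ := circuit_separator_ranks M hC hsep hM hCs
  unfold ThmN.RLS
  rw [heq]
  exact c025_nine_four_disjointSum_circuit (M ↾ (M.E \ C)) (M ↾ C) _ hrs (by omega) hr hcol hcirc
    (by rw [Matroid.restrict_ground_eq]; exact hCs)

/-- **`(9, 4)` for a matroid of rank `9` on `14` points with a triangle separator** (every `(9, 5)` core with a
triangle summand): the other part has rank `7` on `11` points, where `(7, 4)` is Theorem M. -/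
theorem rls_nine_four_of_triangle_separator_of_ncard (M : Matroid α) [M.Finite] {C : Set α}
    (hC : M.IsCircuit C) (hsep : M.eRk (M.E \ C) + M.eRk C = M.eRank) (hC3 : C.ncard = 3)
    (hM : M.eRank = ((9 : ℕ) : ℕ∞)) (hE : M.E.ncard = 14) : ThmN.RLS M 9 4 := by
  obtain ⟨heq, hcirc, -, -⟩ := circuit_separator_setup M hC hsep
  haveI hAfin : (M ↾ (M.E \ C)).Finite := Matroid.restrict_finite (M.ground_finite.subset sdiff_subset)
  haveI hCfin : (M ↾ C).Finite := Matroid.restrict_finite (M.ground_finite.subset hC.subset_ground)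
  have hCs : C.ncard = 2 + 1 := hC3
  obtain ⟨r, hr, hrs⟩ := circuit_separator_ranks M hC hsep hM hCs
  have hr7 : r = 7 := by omega
  subst hr7
  have hE11 : (M ↾ (M.E \ C)).E.ncard = 11 := by
    rw [Matroid.restrict_ground_eq, ncard_sdiff' hC.subset_ground M.ground_finite, hE, hC3]
  unfold ThmN.RLS
  rw [heq]
  exact c025_nine_four_disjointSum_triangle_of_ncard (M ↾ (M.E \ C)) (M ↾ C) _ hr hE11 hcirc
    (by rw [Matroid.restrict_ground_eq]; exact hC3)

/-- **`(9, 4)` for a matroid of rank `9` with a triangle separator, conditional on the cell `(7, 4)` of the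
other part** (`M ↾ (E ∖ C)`, of rank `7`): composes with `rls_seven_four_of_circuit_separator` when that part
has a circuit separator of its own (e.g. `H ⊕ T ⊕ T`). -/
theorem rls_nine_four_of_triangle_separator_of_rls (M : Matroid α) [M.Finite] {C : Set α}
    (hC : M.IsCircuit C) (hsep : M.eRk (M.E \ C) + M.eRk C = M.eRank) (hC3 : C.ncard = 3)
    (hM : M.eRank = ((9 : ℕ) : ℕ∞))
    (h74 : @ThmN.RLS α (M ↾ (M.E \ C)) (Matroid.restrict_finite (M.ground_finite.subset sdiff_subset)) 7 4) :
    ThmN.RLS M 9 4 := by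
  obtain ⟨heq, hcirc, -, -⟩ := circuit_separator_setup M hC hsep
  haveI hAfin : (M ↾ (M.E \ C)).Finite := Matroid.restrict_finite (M.ground_finite.subset sdiff_subset)
  haveI hCfin : (M ↾ C).Finite := Matroid.restrict_finite (M.ground_finite.subset hC.subset_ground)
  have hCs : C.ncard = 2 + 1 := hC3
  obtain ⟨r, hr, hrs⟩ := circuit_separator_ranks M hC hsep hM hCs
  have hr7 : r = 7 := by omega
  subst hr7
  unfold ThmN.RLS
  rw [heq]
  exact c025_nine_four_disjointSum_triangle_of_rls (M ↾ (M.E \ C)) (M ↾ C) _ hr h74 hcirc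
    (by rw [Matroid.restrict_ground_eq]; exact hC3)

/-- **`(8, 4)` for a coloop-free matroid with a circuit separator of `≥ 3` elements.** -/
theorem rls_eight_four_of_circuit_separator (M : Matroid α) [M.Finite] {C : Set α} (hC : M.IsCircuit C)
    (hsep : M.eRk (M.E \ C) + M.eRk C = M.eRank) (hC3 : 3 ≤ C.ncard) (hM : M.eRank = ((8 : ℕ) : ℕ∞))
    (hcolM : M.coloops = ∅) : ThmN.RLS M 8 4 := by
  have hcol := restrict_compl_coloops_eq_empty_of_circuit_separator M hC hsep hcolM
  obtain ⟨heq, hcirc, -, -⟩ := circuit_separator_setup M hC hsep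
  haveI hAfin : (M ↾ (M.E \ C)).Finite := Matroid.restrict_finite (M.ground_finite.subset sdiff_subset)
  haveI hCfin : (M ↾ C).Finite := Matroid.restrict_finite (M.ground_finite.subset hC.subset_ground)
  have hCs : C.ncard = (C.ncard - 1) + 1 := by omega
  obtain ⟨r, hr, hrs⟩ := circuit_separator_ranks M hC hsep hM hCs
  unfold ThmN.RLS
  rw [heq]
  exact c025_eight_four_disjointSum_circuit (M ↾ (M.E \ C)) (M ↾ C) _ hrs (by omega) hr hcol hcirc
    (by rw [Matroid.restrict_ground_eq]; exact hCs)

/-- **`(7, 4)` for a matroid with a circuit separator of `≥ 3` elements** — no further hypothesis. -/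
theorem rls_seven_four_of_circuit_separator (M : Matroid α) [M.Finite] {C : Set α} (hC : M.IsCircuit C)
    (hsep : M.eRk (M.E \ C) + M.eRk C = M.eRank) (hC3 : 3 ≤ C.ncard) (hM : M.eRank = ((7 : ℕ) : ℕ∞)) :
    ThmN.RLS M 7 4 := by
  obtain ⟨heq, hcirc, -, -⟩ := circuit_separator_setup M hC hsep
  haveI hAfin : (M ↾ (M.E \ C)).Finite := Matroid.restrict_finite (M.ground_finite.subset sdiff_subset)
  haveI hCfin : (M ↾ C).Finite := Matroid.restrict_finite (M.ground_finite.subset hC.subset_ground)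
  have hCs : C.ncard = (C.ncard - 1) + 1 := by omega
  obtain ⟨r, hr, hrs⟩ := circuit_separator_ranks M hC hsep hM hCs
  unfold ThmN.RLS
  rw [heq]
  exact c025_seven_four_disjointSum_circuit (M ↾ (M.E \ C)) (M ↾ C) _ hrs (by omega) hr hcirc
    (by rw [Matroid.restrict_ground_eq]; exact hCs)

/-- **`(9, 4)` for a matroid of rank `9` with two disjoint circuit separators, one of them a triangle**: the
triangle `C₂` reduces to the cell `(7, 4)` of `M ↾ (E ∖ C₂)`, where the other circuit `C₁` is still a circuit
separator, so `rls_seven_four_of_circuit_separator` applies. Covers the «`H ⊕ T ⊕ T`» witnesses of the row-9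
caps. -/
theorem rls_nine_four_of_two_circuit_separators (M : Matroid α) [M.Finite] {C₁ C₂ : Set α}
    (hC₁ : M.IsCircuit C₁) (hC₂ : M.IsCircuit C₂) (hdisj : Disjoint C₁ C₂)
    (hsep₁ : M.eRk (M.E \ C₁) + M.eRk C₁ = M.eRank) (hsep₂ : M.eRk (M.E \ C₂) + M.eRk C₂ = M.eRank)
    (hC₁3 : 3 ≤ C₁.ncard) (hC₂3 : C₂.ncard = 3) (hM : M.eRank = ((9 : ℕ) : ℕ∞)) : ThmN.RLS M 9 4 := by
  haveI hBfin : (M ↾ (M.E \ C₂)).Finite := Matroid.restrict_finite (M.ground_finite.subset sdiff_subset)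
  apply rls_nine_four_of_triangle_separator_of_rls M hC₂ hsep₂ hC₂3 hM
  -- the cell `(7, 4)` of the rest, from its own circuit separator `C₁`
  have hC₁E : C₁ ⊆ M.E \ C₂ := fun x hx => ⟨hC₁.subset_ground hx, fun hx2 => hdisj.notMem_of_mem_left hx hx2⟩
  have hcirc : (M ↾ (M.E \ C₂)).IsCircuit C₁ := by
    rw [Matroid.restrict_isCircuit_iff sdiff_subset]
    exact ⟨hC₁, hC₁E⟩
  have hsep₁' : M.eRk (M.E \ C₁) + M.eRk (M.E \ (M.E \ C₁)) = M.eRank := by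
    rw [sdiff_sdiff_cancel_left hC₁.subset_ground]; exact hsep₁
  -- the rank split across the separator `E ∖ C₁` on `X = E ∖ C₂`
  have hsplit := eRk_eq_eRk_inter_add_eRk_sdiff_of_separator M (A := M.E \ C₁) sdiff_subset hsep₁'
    (X := M.E \ C₂) sdiff_subset
  have e1 : (M.E \ C₂) ∩ (M.E \ C₁) = (M.E \ C₂) \ C₁ := by
    ext y; simp only [mem_inter_iff, mem_sdiff]; tauto
  have e2 : (M.E \ C₂) \ (M.E \ C₁) = C₁ := by
    ext y; simp only [mem_sdiff, not_and, not_not]; constructor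
    · rintro ⟨⟨hyE, -⟩, h⟩; exact h hyE
    · intro hy; exact ⟨⟨hC₁.subset_ground hy, hdisj.notMem_of_mem_left hy⟩, fun _ => hy⟩
  rw [e1, e2] at hsplit
  have hsep_res : (M ↾ (M.E \ C₂)).eRk ((M ↾ (M.E \ C₂)).E \ C₁) + (M ↾ (M.E \ C₂)).eRk C₁ =
      (M ↾ (M.E \ C₂)).eRank := by
    rw [Matroid.restrict_ground_eq, Matroid.eRank_restrict, M.restrict_eRk_eq sdiff_subset,
      M.restrict_eRk_eq hC₁E, hsplit]
  have hrank : (M ↾ (M.E \ C₂)).eRank = ((7 : ℕ) : ℕ∞) := by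
    have hC₂s : C₂.ncard = 2 + 1 := hC₂3
    obtain ⟨r, hr, hrs⟩ := circuit_separator_ranks M hC₂ hsep₂ hM hC₂s
    have hr7 : r = 7 := by omega
    rw [hr, hr7]
  exact rls_seven_four_of_circuit_separator (M ↾ (M.E \ C₂)) hcirc hsep_res hC₁3 hrank

end S1

end PercRepro
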